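import Mathlib
import Literature.RingTheory.MvPolynomial.LinearFormsCoeff
import Summits.ValiantsHypothesis.ValiantsHypothesis.Theorems.RigidityForcesSymmetryRankRigidMinimalReprLaplaceFiveStarRestrictionRankThree

/-!
# ValiantsHypothesis / RigidityForcesSymmetry — crux `LaplaceOptimalFive` (stmt-ValiantsHypothesis-24813), crux idea
`young-shadow` (K1) on the star: **ROW RELATIONS OF `Hess m + E` FOR A T1 SLACK — ALL SUPPORTS, SECOND ORDER IN `L`**
(memo `NOTE-p4g15-24813-K1-star.md` §10 «|S| = 1: 4 + 6», «|S| = 2: 7 + 3»; memo `NOTE-p4g16-24813-LemmaK-kernel.md` r2 §4 (v))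

✓ `offDiag_entries_independent` / ✓ `offDiag_relations_of_support_three` used only `L ∣ E_{ab}` and settle `|supp λ| ≥ 3`.
For `|supp λ| ≤ 2` the restriction bound is too weak (memo §10), and one must use the SECOND-ORDER shape of the T1 slack
(✓ `t1_slack_mod_sq`): `E_{ab} ≡ κλ_aλ_b·L·Q (mod L²)`.  This file proves ONE statement for every support:

* ★ `offDiag_relations_fine` — let `λ_{z₀} ≠ 0`, `Q` a quadric, `κ` a scalar.  There is a FIXED matrix `w = w(λ, κ, Q)` such that
  for every symmetric-matrix-of-cubics slack `E_{ab} = C(κλ_aλ_b)·L·Q + L²·V_{ab}` (diagonal included) and every relation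
  `Σ_{a,b} c_{ab}(μ_{ab} + E_{ab}) = 0` (`μ_{ab} = x^{{a,b}ᶜ}` off the diagonal, `0` on it):
  `c_{ab} + c_{ba} = Λ(c)·w_{ab}` for all `a ≠ b`, where `Λ(c) = Σ_{x,y} c_{xy}λ_xλ_y`.
  Proof: the relation says `F := Σ_{a≠b} c_{ab}μ_{ab} = L·G` with the EXPLICIT `G = −(C(κΛ)Q + L·D)`; `F` is squarefree, so
  (✓ `squarefree_of_linForm_mul`) `G`'s monomials are `X_uX_v` with `λ_u = λ_v = 0`, and for those `coeff G = −κΛ·coeff Q`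
  (the `L·D` part has none); reading `c_{ab}+c_{ba} = coeff_{𝟙_{{a,b}ᶜ}}(L·G)` (✓ `coeff_offDiagSum_compl`, ✓ `coeff_linForm_mul`)
  gives the claim with `w_{ab} = −κ Σ_{z∉{a,b}} λ_z·[𝟙_{{a,b}ᶜ} − e_z = e_u + e_v, λ_u = λ_v = 0]·coeff_{e_u+e_v} Q`.
  CONSEQUENCE: the relation module of `Hess m + 4E` satisfies the hypothesis of ✓ `finrank_offDiag_oneRel_le` (≤ 16), so
  ✓ `nine_le_of_offDiag_oneRel` / ✓ `ten_le_of_offDiag_relations` give `≥ 9` generators — more than the `≤ 7` of three T1 splits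
  with the same `λ` plus `r₄ ≤ 3`.

No definitions, no `sorry`.  Honest framing: (L1) brick, closes nothing; the final wiring remains; K1-on-the-star PAPER PASS, not
kernel; `LaplaceOptimalFive` OPEN · CONTESTED 72/120; `VP ≠ VNP` NOT proved.
-/

set_option linter.dupNamespace false

namespace Summit.ValiantsHypothesis.ValiantsHypothesis.Theorems.RigidityForcesSymmetryRankRigidMinimalRepr

namespace LaplaceFiveStar

open Finset MvPolynomial

/-- **Row relations of a T1 slack, all supports (second order in `L`).**  See the module docstring. [folklore] -/
theorem offDiag_relations_fine (lam : Fin 5 → ℂ) (z₀ : Fin 5) (hz₀ : lam z₀ ≠ 0) (Q : MvPolynomial (Fin 5) ℂ) (κ : ℂ) :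
    ∃ w : Fin 5 → Fin 5 → ℂ, ∀ (E V : Fin 5 → Fin 5 → MvPolynomial (Fin 5) ℂ),
      (∀ a b : Fin 5, E a b = C (κ * (lam a * lam b)) * (∑ z : Fin 5, lam z • (X z : MvPolynomial (Fin 5) ℂ)) * Q
        + (∑ z : Fin 5, lam z • (X z : MvPolynomial (Fin 5) ℂ)) ^ 2 * V a b) →
      ∀ c : Fin 5 → Fin 5 → ℂ,
        (∑ a : Fin 5, ∑ b : Fin 5, C (c a b) *
          ((if a = b then 0 else
            monomial (Finsupp.equivFunOnFinite.symm (fun z : Fin 5 => if z = a ∨ z = b then (0 : ℕ) else 1)) 1) + E a b)) = 0 →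
        ∀ a b : Fin 5, a ≠ b →
          c a b + c b a = (∑ x : Fin 5, ∑ y : Fin 5, c x y * (lam x * lam y)) * w a b := by
  classical
  set L : MvPolynomial (Fin 5) ℂ := ∑ z : Fin 5, lam z • (X z : MvPolynomial (Fin 5) ℂ) with hL
  -- the admissible exponents: `e_u + e_v`, `u ≠ v`, `λ_u = λ_v = 0`
  let P : (Fin 5 →₀ ℕ) → Prop := fun d =>
    ∃ i i' : Fin 5, i ≠ i' ∧ lam i = 0 ∧ lam i' = 0 ∧ d = Finsupp.single i 1 + Finsupp.single i' 1
  let w : Fin 5 → Fin 5 → ℂ := fun a b => -κ * ∑ z : Fin 5,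
    (if z ∈ (Finsupp.equivFunOnFinite.symm (fun t : Fin 5 => if t = a ∨ t = b then (0 : ℕ) else 1)).support then
      lam z * (if P (Finsupp.equivFunOnFinite.symm (fun t : Fin 5 => if t = a ∨ t = b then (0 : ℕ) else 1) - Finsupp.single z 1)
        then coeff (Finsupp.equivFunOnFinite.symm (fun t : Fin 5 => if t = a ∨ t = b then (0 : ℕ) else 1) - Finsupp.single z 1) Q
        else 0)
    else 0)
  refine ⟨w, fun E V hE c hrel a b hab => ?_⟩
  have hL1 : L.IsHomogeneous 1 := Literature.RingTheory.MvPolynomial.isHomogeneous_one_sum_smul_X lam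
  have hL0 : L ≠ 0 := by
    intro h0
    have := (Literature.RingTheory.MvPolynomial.sum_smul_X_eq_zero_iff lam).mp h0
    exact hz₀ (by rw [this]; rfl)
  -- the squarefree part `F` and the explicit quotient `G`
  set F : MvPolynomial (Fin 5) ℂ := ∑ a : Fin 5, ∑ b : Fin 5, (if a = b then 0 else
      C (c a b) * monomial (Finsupp.equivFunOnFinite.symm (fun z : Fin 5 => if z = a ∨ z = b then (0 : ℕ) else 1)) 1) with hF
  set Λ : ℂ := ∑ x : Fin 5, ∑ y : Fin 5, c x y * (lam x * lam y) with hΛ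
  set D : MvPolynomial (Fin 5) ℂ := ∑ a : Fin 5, ∑ b : Fin 5, C (c a b) * V a b with hD
  set G : MvPolynomial (Fin 5) ℂ := -(C (κ * Λ) * Q + L * D) with hG
  have hEsum : ∑ a : Fin 5, ∑ b : Fin 5, C (c a b) * E a b = C (κ * Λ) * L * Q + L ^ 2 * D := by
    have h1 : ∀ a b : Fin 5, C (c a b) * E a b
        = (L * Q) * C (c a b * (κ * (lam a * lam b))) + L ^ 2 * (C (c a b) * V a b) := by
      intro a b
      simp only [hE, map_mul]
      ring
    have h2 : ∑ a : Fin 5, ∑ b : Fin 5, C (c a b) * E a b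
        = (L * Q) * C (∑ a : Fin 5, ∑ b : Fin 5, c a b * (κ * (lam a * lam b))) + L ^ 2 * D := by
      rw [hD]
      simp only [h1, Finset.sum_add_distrib, ← Finset.mul_sum, map_sum]
    have h3 : ∑ a : Fin 5, ∑ b : Fin 5, c a b * (κ * (lam a * lam b)) = κ * Λ := by
      rw [hΛ, Finset.mul_sum]
      refine Finset.sum_congr rfl fun a _ => ?_
      rw [Finset.mul_sum]
      exact Finset.sum_congr rfl fun b _ => by ring
    rw [h2, h3]
    ring
  have hFG : F = L * G := by
    have h := hrel
    simp only [mul_add, Finset.sum_add_distrib, mul_ite, mul_zero] at h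
    rw [hEsum] at h
    rw [hG]
    linear_combination h
  -- `F` is a squarefree cubic, so `G` is a quadric with no monomial touching `supp λ`
  have hF3 := coeff_offDiagSum_cube c F hF
  have hF21 : ∀ i i' : Fin 5, i ≠ i' → coeff (Finsupp.single i 2 + Finsupp.single i' 1) F = 0 :=
    fun i i' _ => coeff_offDiagSum_sq c F hF i i'
  have hFh := offDiagSum_isHomogeneous c F hF
  have hGh : G.IsHomogeneous 2 :=
    isHomogeneous_of_mul_eq (d := 2) (m := 1) (n := 3) hL1 hL0 hFh (by rw [hFG]; ring) rfl
  obtain ⟨hdiag, -⟩ := squarefree_of_linForm_mul lam z₀ hz₀ F G hF3 hF21 hFG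
  have hoff := squarefree_of_linForm_mul' lam z₀ hz₀ F G hF3 hF21 hFG
  -- every coefficient of `G`
  have coeffG : ∀ d : Fin 5 →₀ ℕ, coeff d G = -(κ * Λ) * (if P d then coeff d Q else 0) := by
    intro d
    by_cases hP : P d
    · rw [if_pos hP]
      obtain ⟨i, i', hii', hi, hi', rfl⟩ := hP
      have hLD : coeff (Finsupp.single i 1 + Finsupp.single i' 1) (L * D) = 0 := by
        rw [hL, coeff_linForm_mul]
        refine Finset.sum_eq_zero fun z _ => ?_
        by_cases hz : z ∈ (Finsupp.single i 1 + Finsupp.single i' 1).support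
        · have hz' : z = i ∨ z = i' := by
            rw [Finsupp.mem_support_iff, Finsupp.add_apply, Finsupp.single_apply, Finsupp.single_apply] at hz
            by_contra hn
            simp only [not_or] at hn
            rw [if_neg (Ne.symm hn.1), if_neg (Ne.symm hn.2)] at hz
            exact hz rfl
          rcases hz' with rfl | rfl
          · rw [hi, zero_mul]
          · rw [hi', zero_mul]
        · rw [if_neg hz, mul_zero]
      rw [hG, coeff_neg, coeff_add, coeff_C_mul, hLD, add_zero]
      ring
    · rw [if_neg hP, mul_zero]
      by_cases hd : d.degree = 2
      · rcases degree_two_shape d hd with ⟨i, rfl⟩ | ⟨i, i', hii', rfl⟩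
        · exact hdiag i
        · have hl : lam i ≠ 0 ∨ lam i' ≠ 0 := by
            by_contra hn
            simp only [not_or, not_not] at hn
            exact hP ⟨i, i', hii', hn.1, hn.2, rfl⟩
          exact hoff i i' hii' hl
      · exact hGh.coeff_eq_zero hd
  -- read the relation at the squarefree monomial `x^{{a,b}ᶜ}`
  rw [← coeff_offDiagSum_compl c F hF a b hab, hFG, hL, coeff_linForm_mul]
  show _ = Λ * (-κ * _)
  rw [Finset.mul_sum, Finset.mul_sum]
  refine Finset.sum_congr rfl fun z _ => ?_
  by_cases hz : z ∈ (Finsupp.equivFunOnFinite.symm (fun t : Fin 5 => if t = a ∨ t = b then (0 : ℕ) else 1)).support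
  · rw [if_pos hz, if_pos hz, coeffG]
    ring
  · rw [if_neg hz, if_neg hz, mul_zero, mul_zero, mul_zero]

/-- **Packaging for ✓ `nine_le_of_offDiag_oneRel`.**  If every relation has `c_{ab}+c_{ba} = Λ(c)·w_{ab}` with a fixed `w`, then
either all relations are antisymmetric off the diagonal (`w = 0` off the diagonal) or, at a pair with `w_{a₀b₀} ≠ 0`,
`(c_{ab}+c_{ba})·w_{a₀b₀} = (c_{a₀b₀}+c_{b₀a₀})·w_{ab}`. [folklore] -/
theorem oneRel_shape_of_fine (w : Fin 5 → Fin 5 → ℂ) (c : Fin 5 → Fin 5 → ℂ) (Λ : ℂ)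
    (h : ∀ a b : Fin 5, a ≠ b → c a b + c b a = Λ * w a b) (a₀ b₀ : Fin 5) (h₀ : a₀ ≠ b₀) (a b : Fin 5) (hab : a ≠ b) :
    (c a b + c b a) * w a₀ b₀ = (c a₀ b₀ + c b₀ a₀) * w a b := by
  rw [h a b hab, h a₀ b₀ h₀]
  ring
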